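import Literature.Topology.FourManifolds.RegularLevelSplitting
import Mathlib.Analysis.SpecialFunctions.SmoothTransition
import Mathlib.Analysis.Calculus.Deriv.Slope
import Mathlib.Analysis.Calculus.Deriv.MeanValue
import Mathlib.Analysis.Calculus.Deriv.Shift
import Literature.Topology.FourManifolds.MorseProofs
import Literature.Topology.FourManifolds.CobordismMorseFunctions
import Mathlib.Analysis.Calculus.LocalExtr.Basic
import HarnessLib

/-!
# Blending a function into a multiple of a defining function near a compact regular level,
# without creating critical points

Topic `Literature/Topology/FourManifolds`; infrastructure for Phillips' Lemma 1.1 (consumer: the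
named fact
`Literature.Topology.Immersions.Phillips1967_exists_isLocalDiffeomorph_of_isParallelizable`).
Everything here is **proved**; no definitions, no named facts.

Phillips 1967, proof of Lemma 1.1 (p. 176), having produced a Morse function `fᵢ` on each
triad `(Mᵢ₊₁' - Int Mᵢ'; ∂Mᵢ', ∂Mᵢ₊₁')`: *"The `fᵢ` can be fitted together to give a
non-negative, proper Morse function `f` on `M`."*  The fitting requires each `fᵢ` to be brought
to a standard form near the two boundary levels, which is what this file supplies, on the
ambient manifold without boundary `M` (model `𝓡 (k + 1)`):

**Main result** (`exists_blend_eq_mul_near_level`). Let `F, G : M → ℝ` be smooth, let the zero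
set `Σ = {F = 0}` be a regular level of `F` contained in a compact band `F⁻¹[-η, η]`, and
suppose `G = 0` on `Σ`, `dG ≠ 0` on `Σ`, and `G ≥ 0` on the side `{F ≥ 0}` near `Σ`. Then
there is `λ₀ > 0` such that for every `0 < λ ≤ λ₀` and every neighbourhood `N` of `Σ` one can
find `0 < δ < δ₁` and a smooth `G'` with `G' = λ F` on `{F ≤ δ}`, `G' = G` on `{δ₁ ≤ F}`,
`{|F| ≤ δ₁} ⊆ N`, **no critical point of `G'` on `{-δ₁ < F ≤ δ₁}`**, and `G'` pointwise
between `λ F` and `G`. The function is the blend `G' = w(F) · λF + (1 - w(F)) · G` with the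
antitone smooth weight `w = smoothTransition ((δ₁ - ·)/(δ₁ - δ))`.

**Why no critical points appear** (§§1–3, read in a straightening chart `Θ` of `F` about a
point of `Σ`, in which `F` is the `0`-th coordinate `z₀`,
`exists_halfSliceChart_of_not_isMCriticalPt'`): since `G` vanishes on the hyperplane
`{z₀ = 0}`, its tangential derivatives vanish there, so `d(G ∘ Θ⁻¹) = μ dz₀` at the level point
(`fderiv_comp_symm_eq_smul_proj`), with `μ ≥ 0` because `G ≥ 0` on `{z₀ ≥ 0}` (one-sided
minimum) and `μ ≠ 0` because `dG ≠ 0`: **`μ > 0`** (`fderiv_comp_symm_single_pos`). By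
continuity `∂₀(G ∘ Θ⁻¹) ≥ μ/2` on a ball, whence, by the mean value theorem along the normal
segment from the hyperplane (which stays in the ball: Pythagoras), the **linear lower bound**
`G ∘ Θ⁻¹ (z) ≥ (μ/2) z₀` for `z₀ ≥ 0` (`exists_ball_le_fderiv_and_mul_le`). For `λ ≤ μ/2` and
`0 ≤ z₀ ≤ δ₁` the normal derivative of the blend is then
`w'(z₀)(λ z₀ - G∘Θ⁻¹) + w λ + (1 - w) ∂₀(G∘Θ⁻¹) ≥ λ > 0` — the first term is `≥ 0` as
`w' ≤ 0` and `λ z₀ ≤ (μ/2) z₀ ≤ G ∘ Θ⁻¹`, the rest is a convex combination of numbers `≥ λ`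
(`fderiv_blend_comp_symm_single_pos`). Finitely many such balls cover the compact level; `λ₀`
is a common lower bound of the `μ/2`; the band `{|F| ≤ δ₁}` is shrunk into their union, into
`N`, and off the critical set of `F` (`exists_forall_abs_le_subset`).

This is the function-side form of the normalisation of a Morse function near the boundary of
a triad by means of a collar (Milnor, *Lectures on the h-cobordism theorem* (1965), proofs of
Thm. 3.4 / Lemma 3.5 / Thm. 4.1, where `f` is adjusted to a collar coordinate near `V₀, V₁`
before triads are composed), carried out without flows or collars.

## References

* A. Phillips, *Submersions of open manifolds*, Topology **6** (1967), proof of Lemma 1.1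
  (p. 176). [Phillips1967]
* J. Milnor, *Lectures on the h-cobordism theorem* (1965), Thm. 3.4, Lemma 3.5, Thm. 4.1.
  [MilnorHCobordism1965]
-/

open scoped Manifold ContDiff Topology
open Set Function Filter Metric

noncomputable section

universe u

namespace Literature.Topology.FourManifolds

namespace LevelBlending

variable {k : ℕ}

/-! ### §0 Euclidean preliminaries -/

/-- `(single 0 1) 0 = 1`. [folklore] -/
theorem single_apply_zero :
    (EuclideanSpace.single (0 : Fin (k + 1)) (1 : ℝ) : EuclideanSpace ℝ (Fin (k + 1))) 0 = 1 := by
  simp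

/-- The `0`-th coordinate along the normal line `z + s e₀`. [folklore] -/
theorem add_smul_single_apply_zero (z : EuclideanSpace ℝ (Fin (k + 1))) (s : ℝ) :
    (z + s • EuclideanSpace.single (0 : Fin (k + 1)) (1 : ℝ)) 0 = z 0 + s := by
  simp

/-- **Pythagoras for the normal segment.** For `z` in the ball `B(c, r)` with `c 0 = 0`, every
point `z - (z 0) e₀ + s e₀` with `|s| ≤ |z 0|` (the normal segment from the hyperplane point
below `z` up to `z`) lies in the same ball. [folklore] -/
theorem sub_smul_add_smul_single_mem_ball {c z : EuclideanSpace ℝ (Fin (k + 1))} {r : ℝ}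
    (hc : c 0 = 0) (hz : z ∈ ball c r) {s : ℝ} (hs : |s| ≤ |z 0|) :
    z - (z 0) • EuclideanSpace.single (0 : Fin (k + 1)) (1 : ℝ) +
      s • EuclideanSpace.single (0 : Fin (k + 1)) (1 : ℝ) ∈ ball c r := by
  set e : EuclideanSpace ℝ (Fin (k + 1)) := EuclideanSpace.single (0 : Fin (k + 1)) (1 : ℝ)
    with he
  set v : EuclideanSpace ℝ (Fin (k + 1)) := z - c with hv
  have hv0 : v 0 = z 0 := by rw [hv, PiLp.sub_apply, hc, sub_zero]
  have hkey : z - (z 0) • e + s • e - c = (v - (v 0) • e) + s • e := by rw [hv0, hv]; abel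
  have horth : ∀ t : ℝ, inner ℝ (v - (v 0) • e) (t • e) = 0 := fun t => by
    rw [inner_smul_right, he, EuclideanSpace.inner_single_right]
    simp [PiLp.sub_apply, PiLp.smul_apply]
  have hp1 := norm_add_sq_eq_norm_sq_add_norm_sq_of_inner_eq_zero (v - (v 0) • e) (s • e) (horth s)
  have hp2 := norm_add_sq_eq_norm_sq_add_norm_sq_of_inner_eq_zero (v - (v 0) • e) ((v 0) • e)
    (horth (v 0))
  rw [sub_add_cancel] at hp2
  have hns : ‖s • e‖ = |s| := by rw [norm_smul, he, PiLp.norm_single, norm_one, mul_one, Real.norm_eq_abs]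
  have hnv : ‖(v 0) • e‖ = |z 0| := by
    rw [norm_smul, he, PiLp.norm_single, norm_one, mul_one, Real.norm_eq_abs, hv0]
  rw [mem_ball, dist_eq_norm] at hz ⊢
  rw [hkey]
  rw [hns] at hp1
  rw [hnv] at hp2
  have h1 : ‖v - v 0 • e + s • e‖ * ‖v - v 0 • e + s • e‖ ≤ ‖v‖ * ‖v‖ := by
    rw [hp1, hp2]
    nlinarith [abs_nonneg s, abs_nonneg (z 0)]
  have h2 : ‖v - v 0 • e + s • e‖ ≤ ‖v‖ := by
    by_contra hlt
    rw [not_le] at hlt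
    nlinarith [norm_nonneg (v - v 0 • e + s • e), norm_nonneg v]
  exact lt_of_le_of_lt h2 hz

/-! ### §1 A function vanishing on a level, read in a straightening chart -/

section InChart

variable {M : Type u} [TopologicalSpace M] [ChartedSpace (EuclideanSpace ℝ (Fin (k + 1))) M]
  {F G : M → ℝ} {Θ : OpenPartialHomeomorph M (EuclideanSpace ℝ (Fin (k + 1)))}

omit [ChartedSpace (EuclideanSpace ℝ (Fin (k + 1))) M] in
/-- In a straightening chart of `F` (`Θ q 0 = F q` on the source), `F ∘ Θ⁻¹` is the `0`-th
coordinate on the target. [folklore] -/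
theorem apply_symm_eq_apply_zero (hΘF : ∀ q ∈ Θ.source, Θ q 0 = F q)
    {z : EuclideanSpace ℝ (Fin (k + 1))} (hz : z ∈ Θ.target) : F (Θ.symm z) = z 0 := by
  rw [← hΘF _ (Θ.map_target hz), Θ.right_inv hz]

omit [ChartedSpace (EuclideanSpace ℝ (Fin (k + 1))) M] in
/-- A function vanishing on the level `{F = 0}` vanishes, in a straightening chart of `F`, on
the hyperplane `{z₀ = 0}`. [folklore] -/
theorem comp_symm_eq_zero_of_apply_zero (hΘF : ∀ q ∈ Θ.source, Θ q 0 = F q)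
    (hG0 : ∀ x, F x = 0 → G x = 0) {z : EuclideanSpace ℝ (Fin (k + 1))} (hz : z ∈ Θ.target)
    (hz0 : z 0 = 0) : (G ∘ Θ.symm) z = 0 :=
  hG0 _ ((apply_symm_eq_apply_zero hΘF hz).trans hz0)

/-- A smooth function read in a smooth chart is `C^∞` on the target. [folklore] -/
theorem contDiffOn_comp_symm
    (hΘ' : ContMDiffOn 𝓘(ℝ, EuclideanSpace ℝ (Fin (k + 1))) (𝓡 (k + 1)) ∞ Θ.symm Θ.target)
    (hG : ContMDiff (𝓡 (k + 1)) 𝓘(ℝ, ℝ) ∞ G) : ContDiffOn ℝ ∞ (G ∘ Θ.symm) Θ.target :=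
  contMDiffOn_iff_contDiffOn.1 (hG.comp_contMDiffOn hΘ')

/-- A smooth function read in a smooth chart is differentiable at points of the target.
[folklore] -/
theorem hasFDerivAt_comp_symm
    (hΘ' : ContMDiffOn 𝓘(ℝ, EuclideanSpace ℝ (Fin (k + 1))) (𝓡 (k + 1)) ∞ Θ.symm Θ.target)
    (hG : ContMDiff (𝓡 (k + 1)) 𝓘(ℝ, ℝ) ∞ G) {z : EuclideanSpace ℝ (Fin (k + 1))}
    (hz : z ∈ Θ.target) :
    HasFDerivAt (G ∘ Θ.symm) (fderiv ℝ (G ∘ Θ.symm) z) z :=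
  (((contDiffOn_comp_symm hΘ' hG) z hz).contDiffAt (Θ.open_target.mem_nhds hz)).differentiableAt
    (by simp) |>.hasFDerivAt

/-- Along the normal line `s ↦ z + s e₀`, `G ∘ Θ⁻¹` has derivative `∂₀(G ∘ Θ⁻¹)(z)` at `s = 0`.
[folklore] -/
theorem hasDerivAt_comp_symm_line
    (hΘ' : ContMDiffOn 𝓘(ℝ, EuclideanSpace ℝ (Fin (k + 1))) (𝓡 (k + 1)) ∞ Θ.symm Θ.target)
    (hG : ContMDiff (𝓡 (k + 1)) 𝓘(ℝ, ℝ) ∞ G) {z : EuclideanSpace ℝ (Fin (k + 1))}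
    (hz : z ∈ Θ.target) :
    HasDerivAt (fun s : ℝ => (G ∘ Θ.symm) (z + s • EuclideanSpace.single (0 : Fin (k + 1)) (1 : ℝ)))
      (fderiv ℝ (G ∘ Θ.symm) z (EuclideanSpace.single (0 : Fin (k + 1)) (1 : ℝ))) 0 := by
  set e : EuclideanSpace ℝ (Fin (k + 1)) := EuclideanSpace.single (0 : Fin (k + 1)) (1 : ℝ)
  have hℓ : HasDerivAt (fun s : ℝ => z + s • e) e 0 := by
    have := ((hasDerivAt_id (0 : ℝ)).smul_const e).const_add z
    simpa using this
  have h := (hasFDerivAt_comp_symm hΘ' hG (by simpa using hz)).comp_hasDerivAt (0 : ℝ) hℓ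
  rw [zero_smul, add_zero] at h
  exact h

variable {x : M}

/-- **Tangential derivatives vanish on the level**: if `G = 0` on `{F = 0}` and `F x = 0`, then
`d(G ∘ Θ⁻¹)(Θ x) w = 0` whenever `w 0 = 0` (the line `Θ x + s w` stays in the hyperplane, where
`G ∘ Θ⁻¹ = 0`). [folklore] -/
theorem fderiv_comp_symm_apply_eq_zero
    (hΘ' : ContMDiffOn 𝓘(ℝ, EuclideanSpace ℝ (Fin (k + 1))) (𝓡 (k + 1)) ∞ Θ.symm Θ.target)
    (hΘF : ∀ q ∈ Θ.source, Θ q 0 = F q) (hG : ContMDiff (𝓡 (k + 1)) 𝓘(ℝ, ℝ) ∞ G)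
    (hG0 : ∀ x, F x = 0 → G x = 0) (hx : x ∈ Θ.source) (hFx : F x = 0)
    {w : EuclideanSpace ℝ (Fin (k + 1))} (hw : w 0 = 0) :
    fderiv ℝ (G ∘ Θ.symm) (Θ x) w = 0 := by
  set z₀ := Θ x with hz₀
  have hz₀t : z₀ ∈ Θ.target := Θ.map_source hx
  have hz₀0 : z₀ 0 = 0 := by rw [hz₀, hΘF x hx, hFx]
  set ℓ : ℝ → EuclideanSpace ℝ (Fin (k + 1)) := fun s => z₀ + s • w with hℓ
  have hℓ0 : ℓ 0 = z₀ := by simp [hℓ]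
  have hℓd : HasDerivAt ℓ w 0 := by
    have := ((hasDerivAt_id (0 : ℝ)).smul_const w).const_add z₀
    simpa [hℓ] using this
  have h1 : HasDerivAt ((G ∘ Θ.symm) ∘ ℓ) (fderiv ℝ (G ∘ Θ.symm) (ℓ 0) w) 0 :=
    (hasFDerivAt_comp_symm hΘ' hG (hℓ0 ▸ hz₀t)).comp_hasDerivAt 0 hℓd
  rw [hℓ0] at h1
  have hev : ∀ᶠ s in 𝓝 (0 : ℝ), ((G ∘ Θ.symm) ∘ ℓ) s = 0 := by
    have hcont : Continuous ℓ := by fun_prop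
    have hmem : ∀ᶠ s in 𝓝 (0 : ℝ), ℓ s ∈ Θ.target := by
      refine hcont.continuousAt.preimage_mem_nhds ?_
      rw [hℓ0]; exact Θ.open_target.mem_nhds hz₀t
    filter_upwards [hmem] with s hs
    refine comp_symm_eq_zero_of_apply_zero hΘF hG0 hs ?_
    show (z₀ + s • w) 0 = 0
    rw [PiLp.add_apply, PiLp.smul_apply, hw, smul_zero, add_zero, hz₀0]
  have h2 : HasDerivAt ((G ∘ Θ.symm) ∘ ℓ) 0 0 :=
    (hasDerivAt_const (0 : ℝ) (0 : ℝ)).congr_of_eventuallyEq hev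
  exact h1.unique h2

/-- **`d(G ∘ Θ⁻¹)(Θ x)` is a multiple of `dz₀`**: it equals `μ · dz₀` with
`μ = ∂₀(G ∘ Θ⁻¹)(Θ x)`. [folklore] -/
theorem fderiv_comp_symm_eq_smul_proj
    (hΘ' : ContMDiffOn 𝓘(ℝ, EuclideanSpace ℝ (Fin (k + 1))) (𝓡 (k + 1)) ∞ Θ.symm Θ.target)
    (hΘF : ∀ q ∈ Θ.source, Θ q 0 = F q) (hG : ContMDiff (𝓡 (k + 1)) 𝓘(ℝ, ℝ) ∞ G)
    (hG0 : ∀ x, F x = 0 → G x = 0) (hx : x ∈ Θ.source) (hFx : F x = 0) :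
    fderiv ℝ (G ∘ Θ.symm) (Θ x) =
      (fderiv ℝ (G ∘ Θ.symm) (Θ x) (EuclideanSpace.single (0 : Fin (k + 1)) (1 : ℝ))) •
        EuclideanSpace.proj (0 : Fin (k + 1)) := by
  ext w
  set e : EuclideanSpace ℝ (Fin (k + 1)) := EuclideanSpace.single (0 : Fin (k + 1)) (1 : ℝ)
    with he
  have hdec : w = (w 0) • e + (w - (w 0) • e) := by abel
  have htan : (w - (w 0) • e) 0 = 0 := by
    rw [PiLp.sub_apply, PiLp.smul_apply, he, single_apply_zero, smul_eq_mul, mul_one, sub_self]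
  conv_lhs => rw [hdec, map_add, map_smul,
    fderiv_comp_symm_apply_eq_zero hΘ' hΘF hG hG0 hx hFx htan, add_zero]
  simp [mul_comm]

/-- **The normal derivative is `≥ 0`**: if moreover `G ≥ 0` on the side `{F ≥ 0}` near `x`,
then `∂₀(G ∘ Θ⁻¹)(Θ x) ≥ 0` (`G ∘ Θ⁻¹` has a one-sided local minimum at `Θ x` on `{z₀ ≥ 0}`).
[folklore] -/
theorem fderiv_comp_symm_single_nonneg
    (hΘ' : ContMDiffOn 𝓘(ℝ, EuclideanSpace ℝ (Fin (k + 1))) (𝓡 (k + 1)) ∞ Θ.symm Θ.target)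
    (hΘF : ∀ q ∈ Θ.source, Θ q 0 = F q) (hG : ContMDiff (𝓡 (k + 1)) 𝓘(ℝ, ℝ) ∞ G)
    (hG0 : ∀ x, F x = 0 → G x = 0) (hx : x ∈ Θ.source) (hFx : F x = 0)
    (hGpos : ∀ᶠ y in 𝓝 x, 0 ≤ F y → 0 ≤ G y) :
    0 ≤ fderiv ℝ (G ∘ Θ.symm) (Θ x) (EuclideanSpace.single (0 : Fin (k + 1)) (1 : ℝ)) := by
  set e : EuclideanSpace ℝ (Fin (k + 1)) := EuclideanSpace.single (0 : Fin (k + 1)) (1 : ℝ)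
    with he
  set z₀ := Θ x with hz₀
  have hz₀t : z₀ ∈ Θ.target := Θ.map_source hx
  have hz₀0 : z₀ 0 = 0 := by rw [hz₀, hΘF x hx, hFx]
  set s : Set (EuclideanSpace ℝ (Fin (k + 1))) := {z | 0 ≤ z 0} with hs
  have hmin : IsLocalMinOn (G ∘ Θ.symm) s z₀ := by
    have hval : (G ∘ Θ.symm) z₀ = 0 := comp_symm_eq_zero_of_apply_zero hΘF hG0 hz₀t hz₀0
    -- transport `hGpos` to the chart through the continuity of `Θ.symm` at `z₀`
    have hsymm : ContinuousAt Θ.symm z₀ := Θ.continuousAt_symm hz₀t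
    have hx' : Θ.symm z₀ = x := by rw [hz₀, Θ.left_inv hx]
    have hev : ∀ᶠ z in 𝓝 z₀, 0 ≤ F (Θ.symm z) → 0 ≤ G (Θ.symm z) := by
      have := hsymm.eventually (show ∀ᶠ y in 𝓝 (Θ.symm z₀), 0 ≤ F y → 0 ≤ G y by rwa [hx'])
      exact this
    have hmem : ∀ᶠ z in 𝓝 z₀, z ∈ Θ.target := Θ.open_target.mem_nhds hz₀t
    rw [IsLocalMinOn, IsMinFilter, eventually_nhdsWithin_iff]
    filter_upwards [hev, hmem] with z hz hzt hzs
    rw [hval]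
    have hFz : 0 ≤ F (Θ.symm z) := by rw [apply_symm_eq_apply_zero hΘF hzt]; exact hzs
    exact hz hFz
  have hseg : segment ℝ z₀ (z₀ + e) ⊆ s := by
    rw [segment_subset_iff]
    intro a b ha hb hab
    show 0 ≤ (a • z₀ + b • (z₀ + e)) 0
    simp only [PiLp.add_apply, PiLp.smul_apply, smul_eq_mul, hz₀0, he, single_apply_zero]
    nlinarith
  have h := hmin.hasFDerivWithinAt_nonneg (hasFDerivAt_comp_symm hΘ' hG hz₀t).hasFDerivWithinAt
    (mem_posTangentConeAt_of_segment_subset hseg)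
  simpa using h

/-- **The normal derivative is `> 0`** if in addition `dG_x ≠ 0`: `d(G ∘ Θ⁻¹)(Θ x) = μ dz₀`
with `μ ≥ 0`, and `μ = 0` would make `x` a critical point of `G`
(`isMCriticalPt_iff_fderiv_comp_symm_eq_zero`). [folklore] -/
theorem fderiv_comp_symm_single_pos [IsManifold (𝓡 (k + 1)) ∞ M]
    (hΘ : ContMDiffOn (𝓡 (k + 1)) 𝓘(ℝ, EuclideanSpace ℝ (Fin (k + 1))) ∞ Θ Θ.source)
    (hΘ' : ContMDiffOn 𝓘(ℝ, EuclideanSpace ℝ (Fin (k + 1))) (𝓡 (k + 1)) ∞ Θ.symm Θ.target)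
    (hΘF : ∀ q ∈ Θ.source, Θ q 0 = F q) (hG : ContMDiff (𝓡 (k + 1)) 𝓘(ℝ, ℝ) ∞ G)
    (hG0 : ∀ x, F x = 0 → G x = 0) (hx : x ∈ Θ.source) (hFx : F x = 0)
    (hGpos : ∀ᶠ y in 𝓝 x, 0 ≤ F y → 0 ≤ G y) (hGreg : ¬ IsMCriticalPt (𝓡 (k + 1)) G x) :
    0 < fderiv ℝ (G ∘ Θ.symm) (Θ x) (EuclideanSpace.single (0 : Fin (k + 1)) (1 : ℝ)) := by
  refine lt_of_le_of_ne (fderiv_comp_symm_single_nonneg hΘ' hΘF hG hG0 hx hFx hGpos) ?_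
  intro h0
  apply hGreg
  rw [isMCriticalPt_iff_fderiv_comp_symm_eq_zero hΘ hΘ' hx (hG.mdifferentiableAt (by simp)),
    fderiv_comp_symm_eq_smul_proj hΘ' hΘF hG hG0 hx hFx, ← h0, zero_smul]

/-- **Uniform bounds on a ball about the level point.** With `μ = ∂₀(G ∘ Θ⁻¹)(Θ x) > 0`:
there is a ball `B(Θ x, r)`, `B̄ ⊆ Θ.target`, on which `∂₀(G ∘ Θ⁻¹) ≥ μ/2` (continuity of the
derivative) and, consequently, **`G ∘ Θ⁻¹ (z) ≥ (μ/2) · z₀` for `z₀ ≥ 0`** (mean value theorem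
along the normal segment from the hyperplane point `z - z₀ e₀`, where `G ∘ Θ⁻¹ = 0`; the
segment stays in the ball). [folklore] -/
theorem exists_ball_le_fderiv_and_mul_le
    (hΘ' : ContMDiffOn 𝓘(ℝ, EuclideanSpace ℝ (Fin (k + 1))) (𝓡 (k + 1)) ∞ Θ.symm Θ.target)
    (hΘF : ∀ q ∈ Θ.source, Θ q 0 = F q) (hG : ContMDiff (𝓡 (k + 1)) 𝓘(ℝ, ℝ) ∞ G)
    (hG0 : ∀ x, F x = 0 → G x = 0) (hx : x ∈ Θ.source) (hFx : F x = 0) {μ : ℝ}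
    (hμ : 0 < μ)
    (hμeq : fderiv ℝ (G ∘ Θ.symm) (Θ x) (EuclideanSpace.single (0 : Fin (k + 1)) (1 : ℝ)) = μ) :
    ∃ r : ℝ, 0 < r ∧ closedBall (Θ x) r ⊆ Θ.target ∧
      (∀ z ∈ ball (Θ x) r,
        μ / 2 ≤ fderiv ℝ (G ∘ Θ.symm) z (EuclideanSpace.single (0 : Fin (k + 1)) (1 : ℝ))) ∧
      (∀ z ∈ ball (Θ x) r, 0 ≤ z 0 → μ / 2 * z 0 ≤ (G ∘ Θ.symm) z) := by
  set e : EuclideanSpace ℝ (Fin (k + 1)) := EuclideanSpace.single (0 : Fin (k + 1)) (1 : ℝ)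
    with he
  set z₀ := Θ x with hz₀
  set Gc := G ∘ Θ.symm with hGc
  have hz₀t : z₀ ∈ Θ.target := Θ.map_source hx
  have hz₀0 : z₀ 0 = 0 := by rw [hz₀, hΘF x hx, hFx]
  -- a closed ball inside the target
  obtain ⟨r₁, hr₁, hball₁⟩ : ∃ r₁ > 0, closedBall z₀ r₁ ⊆ Θ.target := by
    obtain ⟨r', hr', h⟩ := Metric.isOpen_iff.1 Θ.open_target z₀ hz₀t
    exact ⟨r' / 2, by positivity, (closedBall_subset_ball (by linarith)).trans h⟩
  -- continuity of the normal derivative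
  have hcont : ContinuousOn (fderiv ℝ Gc) Θ.target :=
    (contDiffOn_comp_symm hΘ' hG).continuousOn_fderiv_of_isOpen Θ.open_target (by simp)
  have hcont₀ : ContinuousAt (fun z => fderiv ℝ Gc z e) z₀ :=
    (hcont.continuousAt (Θ.open_target.mem_nhds hz₀t)).clm_apply continuousAt_const
  obtain ⟨r₂, hr₂, hball₂⟩ : ∃ r₂ > 0, ∀ z ∈ ball z₀ r₂, μ / 2 < fderiv ℝ Gc z e := by
    have hev : ∀ᶠ z in 𝓝 z₀, μ / 2 < fderiv ℝ Gc z e :=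
      hcont₀.eventually_const_lt (by show μ / 2 < fderiv ℝ Gc z₀ e; rw [hμeq]; linarith)
    exact Metric.eventually_nhds_iff_ball.1 hev
  set r := min r₁ r₂ with hr
  have hrt : closedBall z₀ r ⊆ Θ.target := (closedBall_subset_closedBall (min_le_left _ _)).trans hball₁
  have hder : ∀ z ∈ ball z₀ r, μ / 2 ≤ fderiv ℝ Gc z e := fun z hz =>
    (hball₂ z (ball_subset_ball (min_le_right _ _) hz)).le
  refine ⟨r, lt_min hr₁ hr₂, hrt, hder, fun z hz hz0 => ?_⟩
  -- the mean value theorem along the normal segment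
  set zh : EuclideanSpace ℝ (Fin (k + 1)) := z - (z 0) • e with hzh
  set φ : ℝ → ℝ := fun s => Gc (zh + s • e) with hφ
  have hseg : ∀ s ∈ Icc 0 (z 0), zh + s • e ∈ ball z₀ r := fun s hs =>
    sub_smul_add_smul_single_mem_ball hz₀0 hz (by rw [abs_of_nonneg hs.1, abs_of_nonneg hz0]; exact hs.2)
  have hφd : ∀ s ∈ Icc 0 (z 0), HasDerivAt φ (fderiv ℝ Gc (zh + s • e) e) s := by
    intro s hs
    have hzt : zh + s • e ∈ Θ.target := hrt (ball_subset_closedBall (hseg s hs))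
    have hℓ : HasDerivAt (fun s : ℝ => zh + s • e) e s := by
      have := ((hasDerivAt_id s).smul_const e).const_add zh
      simpa using this
    exact (hasFDerivAt_comp_symm hΘ' hG hzt).comp_hasDerivAt s hℓ
  have hφ0 : φ 0 = 0 := by
    have hzh0 : zh 0 = 0 := by
      rw [hzh, PiLp.sub_apply, PiLp.smul_apply, he, single_apply_zero, smul_eq_mul, mul_one, sub_self]
    have hzht : zh ∈ Θ.target := by
      have := hseg 0 ⟨le_rfl, hz0⟩
      rw [zero_smul, add_zero] at this
      exact hrt (ball_subset_closedBall this)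
    show Gc (zh + (0 : ℝ) • e) = 0
    rw [zero_smul, add_zero]
    exact comp_symm_eq_zero_of_apply_zero hΘF hG0 hzht hzh0
  have hφ1 : φ (z 0) = Gc z := by
    show Gc (zh + (z 0) • e) = Gc z
    rw [hzh, sub_add_cancel]
  have hmvt := Convex.mul_sub_le_image_sub_of_le_deriv (convex_Icc (0 : ℝ) (z 0))
    (fun s hs => (hφd s hs).continuousAt.continuousWithinAt)
    (fun s hs => (hφd s (interior_subset hs)).differentiableAt.differentiableWithinAt)
    (C := μ / 2) (fun s hs => by
      rw [(hφd s (interior_subset hs)).deriv]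
      exact hder _ (hseg s (interior_subset hs)))
    0 (left_mem_Icc.2 hz0) (z 0) (right_mem_Icc.2 hz0) hz0
  rw [hφ0, hφ1, sub_zero, sub_zero] at hmvt
  exact hmvt


/-! ### §2 The blend `w(F) · λF + (1 - w(F)) · G` read in a straightening chart -/

omit [ChartedSpace (EuclideanSpace ℝ (Fin (k + 1))) M] in
/-- **The blend in the chart**: on the target of a straightening chart of `F`, the blend
`B = w(F) · λF + (1 - w(F)) · G` reads `w(z₀) λ z₀ + (1 - w(z₀)) (G ∘ Θ⁻¹)(z)`. [folklore] -/
theorem blend_comp_symm_apply (hΘF : ∀ q ∈ Θ.source, Θ q 0 = F q) (w : ℝ → ℝ) (lam : ℝ)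
    {z : EuclideanSpace ℝ (Fin (k + 1))} (hz : z ∈ Θ.target) :
    ((fun y => w (F y) * (lam * F y) + (1 - w (F y)) * G y) ∘ Θ.symm) z =
      w (z 0) * (lam * z 0) + (1 - w (z 0)) * (G ∘ Θ.symm) z := by
  simp only [comp_apply, apply_symm_eq_apply_zero hΘF hz]

/-- **The normal derivative of the blend in the chart.** Along the normal line `z + s e₀` the
blend has derivative `w'(z₀)(λ z₀ - G∘Θ⁻¹(z)) + w(z₀) λ + (1 - w(z₀)) ∂₀(G∘Θ⁻¹)(z)` at `s = 0`.
[folklore] -/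
theorem hasDerivAt_blend_comp_symm_line
    (hΘ' : ContMDiffOn 𝓘(ℝ, EuclideanSpace ℝ (Fin (k + 1))) (𝓡 (k + 1)) ∞ Θ.symm Θ.target)
    (hΘF : ∀ q ∈ Θ.source, Θ q 0 = F q) (hG : ContMDiff (𝓡 (k + 1)) 𝓘(ℝ, ℝ) ∞ G)
    {w : ℝ → ℝ} (hw : ContDiff ℝ ∞ w) (lam : ℝ)
    {z : EuclideanSpace ℝ (Fin (k + 1))} (hz : z ∈ Θ.target) :
    HasDerivAt (fun s : ℝ => ((fun y => w (F y) * (lam * F y) + (1 - w (F y)) * G y) ∘ Θ.symm)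
        (z + s • EuclideanSpace.single (0 : Fin (k + 1)) (1 : ℝ)))
      (deriv w (z 0) * (lam * z 0 - (G ∘ Θ.symm) z) + w (z 0) * lam +
        (1 - w (z 0)) * fderiv ℝ (G ∘ Θ.symm) z (EuclideanSpace.single (0 : Fin (k + 1)) (1 : ℝ)))
      0 := by
  set e : EuclideanSpace ℝ (Fin (k + 1)) := EuclideanSpace.single (0 : Fin (k + 1)) (1 : ℝ)
    with he
  -- the three factors
  have hw1 : HasDerivAt (fun s : ℝ => w (z 0 + s)) (deriv w (z 0)) 0 := by
    have h := ((hw.differentiable (by simp)) (z 0 + 0)).hasDerivAt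
    have h' := HasDerivAt.comp_const_add (z 0) 0 h
    simpa using h'
  have hl : HasDerivAt (fun s : ℝ => lam * (z 0 + s)) lam 0 := by
    have := ((hasDerivAt_id (0 : ℝ)).const_add (z 0)).const_mul lam
    simpa using this
  have hψ := hasDerivAt_comp_symm_line hΘ' hG hz
  -- the formula for the blend near `s = 0`
  set φ : ℝ → ℝ := fun s => w (z 0 + s) * (lam * (z 0 + s)) +
    (1 - w (z 0 + s)) * (G ∘ Θ.symm) (z + s • e) with hφ
  have hφd : HasDerivAt φ (deriv w (z 0) * (lam * (z 0 + 0)) + w (z 0 + 0) * lam +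
      ((0 - deriv w (z 0)) * (G ∘ Θ.symm) (z + (0 : ℝ) • e) +
        (1 - w (z 0 + 0)) * fderiv ℝ (G ∘ Θ.symm) z e)) 0 :=
    (hw1.mul hl).add (((hasDerivAt_const (0 : ℝ) (1 : ℝ)).sub hw1).mul hψ)
  have hev : (fun s : ℝ => ((fun y => w (F y) * (lam * F y) + (1 - w (F y)) * G y) ∘ Θ.symm)
      (z + s • e)) =ᶠ[𝓝 0] φ := by
    have hcont : Continuous fun s : ℝ => z + s • e := by fun_prop
    have hmem : ∀ᶠ s in 𝓝 (0 : ℝ), z + s • e ∈ Θ.target := by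
      refine hcont.continuousAt.preimage_mem_nhds ?_
      simpa using Θ.open_target.mem_nhds hz
    filter_upwards [hmem] with s hs
    rw [blend_comp_symm_apply hΘF w lam hs, he, add_smul_single_apply_zero]
  refine (hφd.congr_of_eventuallyEq hev).congr_deriv ?_
  simp only [add_zero, zero_smul, zero_sub]
  ring

/-- **The normal derivative of the blend in the chart, as a partial derivative**: for smooth
`F, G, w`, `∂₀(B ∘ Θ⁻¹)(z)` is the number computed in `hasDerivAt_blend_comp_symm_line`.
[folklore] -/
theorem fderiv_blend_comp_symm_single_eq
    (hΘ' : ContMDiffOn 𝓘(ℝ, EuclideanSpace ℝ (Fin (k + 1))) (𝓡 (k + 1)) ∞ Θ.symm Θ.target)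
    (hΘF : ∀ q ∈ Θ.source, Θ q 0 = F q) (hF : ContMDiff (𝓡 (k + 1)) 𝓘(ℝ, ℝ) ∞ F)
    (hG : ContMDiff (𝓡 (k + 1)) 𝓘(ℝ, ℝ) ∞ G) {w : ℝ → ℝ} (hw : ContDiff ℝ ∞ w) (lam : ℝ)
    {z : EuclideanSpace ℝ (Fin (k + 1))} (hz : z ∈ Θ.target) :
    fderiv ℝ ((fun y => w (F y) * (lam * F y) + (1 - w (F y)) * G y) ∘ Θ.symm) z
        (EuclideanSpace.single (0 : Fin (k + 1)) (1 : ℝ)) =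
      deriv w (z 0) * (lam * z 0 - (G ∘ Θ.symm) z) + w (z 0) * lam +
        (1 - w (z 0)) * fderiv ℝ (G ∘ Θ.symm) z (EuclideanSpace.single (0 : Fin (k + 1)) (1 : ℝ)) := by
  have hB : ContMDiff (𝓡 (k + 1)) 𝓘(ℝ, ℝ) ∞
      (fun y => w (F y) * (lam * F y) + (1 - w (F y)) * G y) := by
    have hwF : ContMDiff (𝓡 (k + 1)) 𝓘(ℝ, ℝ) ∞ fun y => w (F y) := hw.comp_contMDiff hF
    exact (hwF.mul (contMDiff_const.mul hF)).add ((contMDiff_const.sub hwF).mul hG)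
  exact (hasDerivAt_comp_symm_line hΘ' hB hz).unique (hasDerivAt_blend_comp_symm_line hΘ' hΘF hG hw lam hz)

end InChart

/-- **The normal derivative of the blend is at least `λ`** (the real inequality): with
`w' ≤ 0`, `w ≤ 1`, `λ ≤ μ/2`, `z₀ ≥ 0`, `G ≥ (μ/2) z₀` and `∂₀G ≥ μ/2`,
`w'(λ z₀ - G) + w λ + (1 - w) ∂₀G ≥ λ`. [folklore] -/
theorem le_blend_deriv {w' w lam μ z0 Gz dGz : ℝ} (hw' : w' ≤ 0) (hw1 : w ≤ 1)
    (hlam : lam ≤ μ / 2) (hz0 : 0 ≤ z0) (hG : μ / 2 * z0 ≤ Gz) (hdG : μ / 2 ≤ dGz) :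
    lam ≤ w' * (lam * z0 - Gz) + w * lam + (1 - w) * dGz := by
  have h1 : lam * z0 - Gz ≤ 0 := by nlinarith
  have h2 : 0 ≤ w' * (lam * z0 - Gz) := mul_nonneg_of_nonpos_of_nonpos hw' h1
  nlinarith

/-! ### §3 Shrinking a band of levels into an open set -/

section Shrink

variable {X : Type*} [TopologicalSpace X]

/-- **Thin bands of levels shrink to the level**: if `F⁻¹[-η, η]` is compact (`η > 0`) and
`V` is an open set containing the zero set `{F = 0}` of the continuous `F`, then
`{|F| ≤ δ₁} ⊆ V` for some `0 < δ₁ ≤ η` (the minimum of `|F|` on the compact set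
`F⁻¹[-η, η] ∖ V` is positive). [folklore] -/
theorem exists_forall_abs_le_subset {F : X → ℝ} (hF : Continuous F) {η : ℝ} (hη : 0 < η)
    (hcpt : IsCompact (F ⁻¹' Icc (-η) η)) {V : Set X} (hV : IsOpen V)
    (hZV : F ⁻¹' {0} ⊆ V) : ∃ δ₁ : ℝ, 0 < δ₁ ∧ δ₁ ≤ η ∧ {y | |F y| ≤ δ₁} ⊆ V := by
  set A : Set X := F ⁻¹' Icc (-η) η ∩ Vᶜ with hA
  have hAc : IsCompact A := hcpt.inter_right hV.isClosed_compl
  rcases A.eq_empty_or_nonempty with hAe | hAne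
  · refine ⟨η, hη, le_rfl, fun y hy => ?_⟩
    by_contra hyV
    have : y ∈ A := ⟨abs_le.1 hy, hyV⟩
    rw [hAe] at this
    exact this
  · obtain ⟨y₀, hy₀A, hmin⟩ := hAc.exists_isMinOn hAne (continuous_abs.comp hF).continuousOn
    have hpos : 0 < |F y₀| := by
      rw [abs_pos]
      intro h0
      exact hy₀A.2 (hZV h0)
    refine ⟨min η (|F y₀| / 2), lt_min hη (by linarith), min_le_left _ _, fun y hy => ?_⟩
    by_contra hyV
    have hyA : y ∈ A := ⟨abs_le.1 (hy.trans (min_le_left _ _)), hyV⟩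
    have h1 : |F y₀| ≤ |F y| := hmin hyA
    have h2 : |F y| ≤ |F y₀| / 2 := hy.trans (min_le_right _ _)
    linarith

end Shrink

/-! ### §4 Criticality helpers on the manifold -/

section Critical

variable {M : Type u} [TopologicalSpace M] [ChartedSpace (EuclideanSpace ℝ (Fin (k + 1))) M]

/-- Criticality is preserved under multiplication by a nonzero constant (chain rule,
`isMCriticalPt_comp_iff_of_hasDerivAt`). [folklore] -/
theorem isMCriticalPt_const_mul_iff {F : M → ℝ} {x : M} {lam : ℝ} (hlam : lam ≠ 0)
    (hF : MDifferentiableAt (𝓡 (k + 1)) 𝓘(ℝ, ℝ) F x) :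
    IsMCriticalPt (𝓡 (k + 1)) (fun y => lam * F y) x ↔ IsMCriticalPt (𝓡 (k + 1)) F x := by
  have hσ : HasDerivAt (fun t : ℝ => lam * t) lam (F x) := by
    simpa using (hasDerivAt_id (F x)).const_mul lam
  exact isMCriticalPt_comp_iff_of_hasDerivAt (σ := fun t : ℝ => lam * t) hσ hlam hF

/-- Criticality only depends on the germ. [folklore] -/
theorem isMCriticalPt_congr_of_eventuallyEq {f g : M → ℝ} {x : M} (h : f =ᶠ[𝓝 x] g) :
    IsMCriticalPt (𝓡 (k + 1)) f x ↔ IsMCriticalPt (𝓡 (k + 1)) g x := by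
  unfold IsMCriticalPt
  rw [h.mfderiv_eq]
  exact Iff.rfl

/-- `x` is critical for `c - F` iff it is critical for `F` (chain rule). [folklore] -/
theorem isMCriticalPt_const_sub_iff {F : M → ℝ} {x : M} (c : ℝ)
    (hF : MDifferentiableAt (𝓡 (k + 1)) 𝓘(ℝ, ℝ) F x) :
    IsMCriticalPt (𝓡 (k + 1)) (fun y => c - F y) x ↔ IsMCriticalPt (𝓡 (k + 1)) F x := by
  have hσ : HasDerivAt (fun t : ℝ => c - t) (-1) (F x) := by
    simpa using (hasDerivAt_id (F x)).const_sub c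
  exact isMCriticalPt_comp_iff_of_hasDerivAt (σ := fun t : ℝ => c - t) hσ (by norm_num) hF

/-- **A straightening chart in which `F` itself is the `0`-th coordinate** about a regular
point of `F` (the chart of `exists_halfSliceChart_of_not_isMCriticalPt'` for `0 - F` at the
level `0`). [cite: Milnor1963, Thm. 3.1] -/
theorem exists_chart_apply_zero_eq [IsManifold (𝓡 (k + 1)) ∞ M] {F : M → ℝ}
    (hF : ContMDiff (𝓡 (k + 1)) 𝓘(ℝ, ℝ) ∞ F) {x : M} (hx : ¬ IsMCriticalPt (𝓡 (k + 1)) F x) :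
    ∃ Θ : OpenPartialHomeomorph M (EuclideanSpace ℝ (Fin (k + 1))),
      ContMDiffOn (𝓡 (k + 1)) 𝓘(ℝ, EuclideanSpace ℝ (Fin (k + 1))) ∞ Θ Θ.source ∧
      ContMDiffOn 𝓘(ℝ, EuclideanSpace ℝ (Fin (k + 1))) (𝓡 (k + 1)) ∞ Θ.symm Θ.target ∧
      x ∈ Θ.source ∧ ∀ q ∈ Θ.source, Θ q 0 = F q := by
  have hF' : ContMDiff (𝓡 (k + 1)) 𝓘(ℝ, ℝ) ∞ fun y => 0 - F y := contMDiff_const.sub hF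
  have hx' : ¬ IsMCriticalPt (𝓡 (k + 1)) (fun y => 0 - F y) x := by
    rwa [isMCriticalPt_const_sub_iff 0 (hF.mdifferentiableAt (by simp))]
  obtain ⟨D, hxD, hD⟩ := exists_halfSliceChart_of_not_isMCriticalPt' hF' 0 hx'
  refine ⟨D.Θ, D.contMDiffOn_toFun, D.contMDiffOn_symm, hxD, fun q hq => ?_⟩
  rw [hD q hq]; ring

end Critical

/-! ### §5 The blending theorem -/

section Main

variable {M : Type u} [TopologicalSpace M] [ChartedSpace (EuclideanSpace ℝ (Fin (k + 1))) M]
  [IsManifold (𝓡 (k + 1)) ∞ M]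

/-- **Blending a function into a multiple of a defining function near a compact regular level,
without creating critical points.** Let `F, G` be smooth on the manifold without boundary `M`;
assume the band `F⁻¹[-η, η]` is compact (`η > 0`), `dF ≠ 0` on the zero set `{F = 0}`,
`G = 0` and `dG ≠ 0` on `{F = 0}`, and `G ≥ 0` on the side `{F ≥ 0}` near `{F = 0}`. Then there
is `λ₀ > 0` such that for all `0 < λ ≤ λ₀` and every neighbourhood `N` of `{F = 0}` there are
`0 < δ < δ₁` with `{|F| ≤ δ₁} ⊆ N` and a smooth `G'` with: `G' = λ F` on `{F ≤ δ}`; `G' = G`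
on `{δ₁ ≤ F}`; **no critical point on `{-δ₁ < F ≤ δ₁}`**; and
`min (λF, G) ≤ G' ≤ max (λF, G)` everywhere. (`G' = w(F) λF + (1 - w(F)) G` with
`w = smoothTransition ((δ₁ - ·)/(δ₁ - δ))`; see the module docstring for the estimate.) This is
the normalisation of a triad Morse function near a boundary level used to fit the `fᵢ`
together in Phillips' proof of Lemma 1.1. [cite: Phillips1967, proof of Lemma 1.1 (p. 176)] -/
theorem exists_blend_eq_mul_near_level {F G : M → ℝ}
    (hF : ContMDiff (𝓡 (k + 1)) 𝓘(ℝ, ℝ) ∞ F) (hG : ContMDiff (𝓡 (k + 1)) 𝓘(ℝ, ℝ) ∞ G)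
    {η : ℝ} (hη : 0 < η) (hcpt : IsCompact (F ⁻¹' Icc (-η) η))
    (hreg : ∀ x, F x = 0 → ¬ IsMCriticalPt (𝓡 (k + 1)) F x)
    (hG0 : ∀ x, F x = 0 → G x = 0) (hGreg : ∀ x, F x = 0 → ¬ IsMCriticalPt (𝓡 (k + 1)) G x)
    (hGpos : ∀ x, F x = 0 → ∀ᶠ y in 𝓝 x, 0 ≤ F y → 0 ≤ G y) :
    ∃ lam₀ : ℝ, 0 < lam₀ ∧ ∀ lam : ℝ, 0 < lam → lam ≤ lam₀ → ∀ N ∈ 𝓝ˢ (F ⁻¹' {0}),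
      ∃ δ δ₁ : ℝ, 0 < δ ∧ δ < δ₁ ∧ {y | |F y| ≤ δ₁} ⊆ N ∧
        ∃ G' : M → ℝ, ContMDiff (𝓡 (k + 1)) 𝓘(ℝ, ℝ) ∞ G' ∧
          (∀ y, F y ≤ δ → G' y = lam * F y) ∧
          (∀ y, δ₁ ≤ F y → G' y = G y) ∧
          (∀ y, -δ₁ < F y → F y ≤ δ₁ → ¬ IsMCriticalPt (𝓡 (k + 1)) G' y) ∧
          (∀ y, min (lam * F y) (G y) ≤ G' y ∧ G' y ≤ max (lam * F y) (G y)) := by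
  classical
  set e : EuclideanSpace ℝ (Fin (k + 1)) := EuclideanSpace.single (0 : Fin (k + 1)) (1 : ℝ)
    with he
  set Z : Set M := F ⁻¹' {0} with hZ
  have hZc : IsCompact Z := hcpt.of_isClosed_subset (isClosed_singleton.preimage hF.continuous)
    (preimage_mono (by
      intro t ht
      rw [mem_singleton_iff] at ht
      subst ht
      exact ⟨by linarith, by linarith⟩))
  -- the chart data at every point of the level
  have hdata : ∀ x : Z, ∃ (Θ : OpenPartialHomeomorph M (EuclideanSpace ℝ (Fin (k + 1))))
      (r μ : ℝ),
      ContMDiffOn (𝓡 (k + 1)) 𝓘(ℝ, EuclideanSpace ℝ (Fin (k + 1))) ∞ Θ Θ.source ∧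
      ContMDiffOn 𝓘(ℝ, EuclideanSpace ℝ (Fin (k + 1))) (𝓡 (k + 1)) ∞ Θ.symm Θ.target ∧
      (∀ q ∈ Θ.source, Θ q 0 = F q) ∧ x.1 ∈ Θ.source ∧ 0 < r ∧ 0 < μ ∧
      closedBall (Θ x.1) r ⊆ Θ.target ∧
      (∀ z ∈ ball (Θ x.1) r, μ / 2 ≤ fderiv ℝ (G ∘ Θ.symm) z e) ∧
      (∀ z ∈ ball (Θ x.1) r, 0 ≤ z 0 → μ / 2 * z 0 ≤ (G ∘ Θ.symm) z) := by
    rintro ⟨x, hx⟩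
    have hFx : F x = 0 := hx
    obtain ⟨Θ, hΘ, hΘ', hxs, hΘF⟩ := exists_chart_apply_zero_eq hF (hreg x hFx)
    set μ := fderiv ℝ (G ∘ Θ.symm) (Θ x) e with hμdef
    have hμ : 0 < μ := fderiv_comp_symm_single_pos hΘ hΘ' hΘF hG hG0 hxs hFx (hGpos x hFx)
      (hGreg x hFx)
    obtain ⟨r, hr, hcl, hder, hlow⟩ :=
      exists_ball_le_fderiv_and_mul_le hΘ' hΘF hG hG0 hxs hFx hμ hμdef.symm
    exact ⟨Θ, r, μ, hΘ, hΘ', hΘF, hxs, hr, hμ, hcl, hder, hlow⟩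
  choose Θ r μ hΘ hΘ' hΘF hxs hr hμ hcl hder hlow using hdata
  -- finitely many chart balls cover the compact level
  set U : Z → Set M := fun x => (Θ x).source ∩ Θ x ⁻¹' ball (Θ x x.1) (r x) with hU
  have hUo : ∀ x, IsOpen (U x) := fun x =>
    (Θ x).continuousOn.isOpen_inter_preimage (Θ x).open_source isOpen_ball
  have hZU : Z ⊆ ⋃ x, U x := fun y hy =>
    mem_iUnion.2 ⟨⟨y, hy⟩, hxs ⟨y, hy⟩, mem_ball_self (hr ⟨y, hy⟩)⟩
  obtain ⟨t, ht⟩ := hZc.elim_finite_subcover U hUo hZU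
  -- the common threshold `λ₀ ≤ μ_x / 2`
  set lam₀ : ℝ := (∑ x ∈ t, (μ x / 2)⁻¹ + 1)⁻¹ with hlam₀
  have hsum : 0 ≤ ∑ x ∈ t, (μ x / 2)⁻¹ :=
    Finset.sum_nonneg fun x _ => (inv_pos.2 (half_pos (hμ x))).le
  have hlam₀_pos : 0 < lam₀ := by rw [hlam₀]; positivity
  have hlam₀_le : ∀ x ∈ t, lam₀ ≤ μ x / 2 := by
    intro x hx
    rw [hlam₀, inv_le_comm₀ (by positivity) (half_pos (hμ x))]
    have := Finset.single_le_sum (f := fun x => (μ x / 2)⁻¹)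
      (fun x _ => (inv_pos.2 (half_pos (hμ x))).le) hx
    linarith
  refine ⟨lam₀, hlam₀_pos, fun lam hlam hlamle N hN => ?_⟩
  -- shrink the band into `interior N`, the balls, and the regular set of `F`
  set V : Set M := interior N ∩ (⋃ x ∈ t, U x) ∩ (criticalSet (𝓡 (k + 1)) F)ᶜ with hV
  have hVo : IsOpen V :=
    (isOpen_interior.inter (isOpen_biUnion fun x _ => hUo x)).inter
      (isClosed_criticalSet_of_contMDiff hF (by norm_cast)).isOpen_compl
  have hZV : Z ⊆ V := fun y hy =>
    ⟨⟨subset_interior_iff_mem_nhdsSet.2 hN hy, ht hy⟩, fun hc => hreg y hy hc⟩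
  obtain ⟨δ₁, hδ₁, -, hband⟩ := exists_forall_abs_le_subset hF.continuous hη hcpt hVo hZV
  set δ : ℝ := δ₁ / 2 with hδ
  have hδpos : 0 < δ := by positivity
  have hδlt : δ < δ₁ := by rw [hδ]; linarith
  -- the weight
  set w : ℝ → ℝ := fun s => Real.smoothTransition ((δ₁ - s) / (δ₁ - δ)) with hw
  have hgap : 0 < δ₁ - δ := by linarith
  have hw_smooth : ContDiff ℝ ∞ w :=
    Real.smoothTransition.contDiff.comp ((contDiff_const.sub contDiff_id).div_const _)
  have hw_anti : Antitone w := by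
    intro a b hab
    exact Real.smoothTransition.monotone (div_le_div_of_nonneg_right (by linarith) hgap.le)
  have hw01 : ∀ s, w s ∈ Icc (0 : ℝ) 1 := fun s =>
    ⟨Real.smoothTransition.nonneg _, Real.smoothTransition.le_one _⟩
  have hw_one : ∀ s, s ≤ δ → w s = 1 := fun s hs =>
    Real.smoothTransition.one_of_one_le ((one_le_div hgap).2 (by linarith))
  have hw_zero : ∀ s, δ₁ ≤ s → w s = 0 := fun s hs =>
    Real.smoothTransition.zero_of_nonpos (div_nonpos_of_nonpos_of_nonneg (by linarith) hgap.le)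
  have hw_deriv : ∀ s, deriv w s ≤ 0 := fun s => hw_anti.deriv_nonpos
  -- the blend
  set G' : M → ℝ := fun y => w (F y) * (lam * F y) + (1 - w (F y)) * G y with hG'
  have hwF : ContMDiff (𝓡 (k + 1)) 𝓘(ℝ, ℝ) ∞ fun y => w (F y) := hw_smooth.comp_contMDiff hF
  have hG's : ContMDiff (𝓡 (k + 1)) 𝓘(ℝ, ℝ) ∞ G' :=
    (hwF.mul (contMDiff_const.mul hF)).add ((contMDiff_const.sub hwF).mul hG)
  have hG'_low : ∀ y, F y ≤ δ → G' y = lam * F y := fun y hy => by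
    simp only [hG', hw_one _ hy]; ring
  have hG'_high : ∀ y, δ₁ ≤ F y → G' y = G y := fun y hy => by
    simp only [hG', hw_zero _ hy]; ring
  have hbandN : {y | |F y| ≤ δ₁} ⊆ N := fun y hy => interior_subset (hband hy).1.1
  refine ⟨δ, δ₁, hδpos, hδlt, hbandN, G', hG's, hG'_low, hG'_high, fun y hy1 hy2 => ?_,
    fun y => ?_⟩
  · -- no critical points on the band `{-δ₁ < F ≤ δ₁}`
    have hyV : y ∈ V := hband (abs_le.2 ⟨hy1.le, hy2⟩)
    rcases lt_or_ge (F y) 0 with hneg | hnonneg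
    · -- below the level: `G' = λ F` near `y`, and `F` is regular there
      have hev : G' =ᶠ[𝓝 y] fun y => lam * F y := by
        have hopen : IsOpen {y' | F y' < δ} := isOpen_lt hF.continuous continuous_const
        filter_upwards [hopen.mem_nhds (show F y < δ by linarith)] with y' hy'
        exact hG'_low y' (le_of_lt hy')
      rw [isMCriticalPt_congr_of_eventuallyEq hev,
        isMCriticalPt_const_mul_iff hlam.ne' (hF.mdifferentiableAt (by simp))]
      exact hyV.2
    · -- on `{0 ≤ F ≤ δ₁}`: read in one of the chart balls
      obtain ⟨x, hxt, hyU⟩ : ∃ x ∈ t, y ∈ U x := by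
        have := hyV.1.2
        simpa only [mem_iUnion, exists_prop] using this
      set z := Θ x y with hzdef
      have hysrc : y ∈ (Θ x).source := hyU.1
      have hzball : z ∈ ball (Θ x x.1) (r x) := hyU.2
      have hzt : z ∈ (Θ x).target := (Θ x).map_source hysrc
      have hz0 : z 0 = F y := hΘF x y hysrc
      intro hcrit
      have h0 : fderiv ℝ (G' ∘ (Θ x).symm) z = 0 :=
        (isMCriticalPt_iff_fderiv_comp_symm_eq_zero (hΘ x) (hΘ' x) hysrc
          (hG's.mdifferentiableAt (by simp))).1 hcrit
      have h1 : fderiv ℝ (G' ∘ (Θ x).symm) z e =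
          deriv w (z 0) * (lam * z 0 - (G ∘ (Θ x).symm) z) + w (z 0) * lam +
            (1 - w (z 0)) * fderiv ℝ (G ∘ (Θ x).symm) z e :=
        fderiv_blend_comp_symm_single_eq (hΘ' x) (hΘF x) hF hG hw_smooth lam hzt
      have h2 : lam ≤ fderiv ℝ (G' ∘ (Θ x).symm) z e := by
        rw [h1]
        refine le_blend_deriv (hw_deriv _) (hw01 _).2 (hlamle.trans (hlam₀_le x hxt))
          (by rw [hz0]; exact hnonneg) (hlow x z hzball (by rw [hz0]; exact hnonneg))
          (hder x z hzball)
      rw [h0] at h2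
      exact absurd (lt_of_lt_of_le hlam h2) (lt_irrefl _)
  · -- convex combination bounds
    have h0 := (hw01 (F y)).1
    have h1 := (hw01 (F y)).2
    constructor
    · show min (lam * F y) (G y) ≤ w (F y) * (lam * F y) + (1 - w (F y)) * G y
      nlinarith [min_le_left (lam * F y) (G y), min_le_right (lam * F y) (G y)]
    · show w (F y) * (lam * F y) + (1 - w (F y)) * G y ≤ max (lam * F y) (G y)
      nlinarith [le_max_left (lam * F y) (G y), le_max_right (lam * F y) (G y)]

end Main

end LevelBlending

end Literature.Topology.FourManifolds
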